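import Summits.NavierStokesRegularity.NavierStokesRegularity.Theses.AxisymmetricExtremality
import Summits.NavierStokesRegularity.NavierStokesRegularity.Theorems.AxisymmetricExtremalityAxisymmetricKatoGlobalStubKatoAxisymSingularPoint
import Summits.NavierStokesRegularity.NavierStokesRegularity.Theorems.AxisymmetricExtremalityAxisymmetricKatoGlobalStubKatoLocalEnergyNearTop
import Summits.NavierStokesRegularity.NavierStokesRegularity.Theorems.AxisymmetricExtremalityAxisymmetricKatoGlobalStubOffAxisBoundedOfLocalEnergy
import Summits.NavierStokesRegularity.NavierStokesRegularity.Theorems.AxisymmetricExtremalityAxisymmetricKatoGlobalReduction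
import Summits.NavierStokesRegularity.NavierStokesRegularity.Theorems.AxisymmetricExtremalityAxisymmetricKatoGlobalNoSwirlStratum
import Summits.NavierStokesRegularity.NavierStokesRegularity.Theorems.AxisymmetricExtremalityPFoldToAxisymmetric
import Literature.Analysis.FluidPDE.AxisymmetricReflection
import Literature.Analysis.FluidPDE.AxisymmetricTypeIBounded
import HarnessLib.Audit

/-!
# Strategist census exhibits (family `s`, gen 13) — crux `AxisymmetricExtremality.AxisymmetricKatoGlobal`
# (stmt-NavierStokesRegularity-15453)

Kernel-checked exhibits for `STRATEGY-CENSUS-s12.md` (second independent census).  Nothing here is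
a line or a stub; every theorem is sorry-free.  Sections follow the census order of this seat's
instruction: (1) weakest replacement of the crux computed from the summit statement and the
route's `closes`; (2) the best typed decomposition with its assembly PROVED from the landed stubs;
(3) transfer from the solved sibling (swirl-free / mirror-symmetric stratum); (4) strengthenings.
-/

noncomputable section

open Set MeasureTheory Filter Topology Function Metric
open scoped ENNReal NNReal
open Literature.Analysis.FluidPDE Literature.Analysis.FunctionSpaces
open Summit.NavierStokesRegularity.NavierStokesRegularity.Theorems.AxisymmetricKatoGlobal

namespace Summit.NavierStokesRegularity.NavierStokesRegularity.Cruxes.AxisymmetricKatoGlobal.StrategistS12g13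

set_option linter.unusedVariables false
set_option linter.dupNamespace false

local notation "ℝ³" => EuclideanSpace ℝ (Fin 3)

/-! ## §1  Weakest replacement of the crux, read off the summit statement and `closes`

`closes` consumes `AxisymmetricKatoGlobal` only at an axisymmetric Rusin–Šverák MINIMAL blow-up
datum.  The weakest statement that can stand in its place is therefore `NoAxisymMinimalDatum`
(W₀).  It is implied by the crux, it closes the summit together with the other two route items
(one of them proved), and over the proved `PFoldToAxisymmetric` it is equivalent to "eventually in
`p`, no `p`-fold symmetric minimal blow-up datum" — i.e. it is exactly the output the Smith-theory
crux `MinimalDatumPFold` is shaped to contradict. -/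

/-- W₀: there is no axisymmetric Rusin–Šverák minimal blow-up datum. -/
def NoAxisymMinimalDatum : Prop :=
  ∀ ν : ℝ, 0 < ν → ∀ (u₀ : ℝ³ → ℝ³) (g : HomSobolev ℝ³ (EuclideanSpace ℂ (Fin 3)) (1 / 2 : ℝ)),
    IsMinimalBlowupDatum ν u₀ g → IsAxisymmetric u₀ → False

/-- "Eventually in `p`, no `p`-fold symmetric minimal blow-up datum" (the negation of the output of
`MinimalDatumPFold`, with the rotation by `2π/p` about the `x₂`-axis). -/
def EventuallyNoPFoldMinimalDatum : Prop :=
  ∀ ν : ℝ, 0 < ν → ∃ N : ℕ, ∀ p : ℕ, N ≤ p → 2 ≤ p →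
    ∀ (u₀ : ℝ³ → ℝ³) (g : HomSobolev ℝ³ (EuclideanSpace ℂ (Fin 3)) (1 / 2 : ℝ)),
      IsMinimalBlowupDatum ν u₀ g → (∀ x : ℝ³, u₀ (rotZ (2 * Real.pi / p) x) = rotZ (2 * Real.pi / p) (u₀ x)) → False

/-- The crux implies W₀ (one line: the minimality clause `¬ HasGlobalKatoSolution`). -/
theorem noAxisymMinimalDatum_of_crux (h : Theses.AxisymmetricExtremality.AxisymmetricKatoGlobal) :
    NoAxisymMinimalDatum := by
  intro ν hν u₀ g hmin hax
  obtain ⟨hL3, hrep, hdiv, -, hnot⟩ := hmin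
  exact hnot (h ν hν u₀ g hL3 hrep hdiv (fun θ x => hax θ x))

/-- W₀ replaces the crux in the deciding theorem: same proof as `closes`. -/
theorem summit_of_noAxisymMinimalDatum (h₂ : Theses.AxisymmetricExtremality.MinimalDatumPFold)
    (h₄ : Theses.AxisymmetricExtremality.PFoldToAxisymmetric) (h₀ : NoAxisymMinimalDatum) :
    NavierStokesRegularity := by
  show Literature.NS.NavierStokesExistenceSmoothR3
  intro ν hν u₀ hsm hdiv hdec
  by_contra hno
  obtain ⟨u₁, g, hmin, hax⟩ := h₄ ν hν (h₂ ν hν ⟨u₀, hsm, hdiv, hdec, hno⟩)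
  exact h₀ ν hν u₁ g hmin (fun θ x => hax θ x)

/-- … and with the PROVED `PFoldToAxisymmetric` (p15454) inlined: the summit from the open Smith
crux and W₀ alone. -/
theorem summit_of_noAxisymMinimalDatum' (h₂ : Theses.AxisymmetricExtremality.MinimalDatumPFold)
    (h₀ : NoAxisymMinimalDatum) : NavierStokesRegularity :=
  summit_of_noAxisymMinimalDatum h₂ Theorems.axisymmetricExtremality_pFoldToAxisymmetric_proof h₀

/-- W₀ ⇒ eventually no `p`-fold minimal data (via the proved compactness upgrade). -/
theorem eventuallyNoPFold_of_noAxisym (h₀ : NoAxisymMinimalDatum) : EventuallyNoPFoldMinimalDatum := by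
  intro ν hν
  by_contra hN
  push Not at hN
  have hin : ∀ N : ℕ, ∃ p : ℕ, N ≤ p ∧ 2 ≤ p ∧ ∃ (u₀ : ℝ³ → ℝ³)
      (g : HomSobolev ℝ³ (EuclideanSpace ℂ (Fin 3)) (1 / 2 : ℝ)), IsMinimalBlowupDatum ν u₀ g ∧
      ∀ x : ℝ³, u₀ (rotZ (2 * Real.pi / p) x) = rotZ (2 * Real.pi / p) (u₀ x) := by
    intro N
    obtain ⟨p, hNp, h2p, u₀, g, hmin, hrot, -⟩ := hN N
    exact ⟨p, hNp, h2p, u₀, g, hmin, hrot⟩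
  obtain ⟨u₁, g, hmin, hax⟩ := Theorems.axisymmetricExtremality_pFoldToAxisymmetric_proof ν hν hin
  exact h₀ ν hν u₁ g hmin (fun θ x => hax θ x)

/-- Eventually no `p`-fold minimal data ⇒ W₀ (an axisymmetric field is `p`-fold for every `p`). -/
theorem noAxisym_of_eventuallyNoPFold (h : EventuallyNoPFoldMinimalDatum) : NoAxisymMinimalDatum := by
  intro ν hν u₀ g hmin hax
  obtain ⟨N, hN⟩ := h ν hν
  exact hN (max N 2) (le_max_left _ _) (le_max_right _ _) u₀ g hmin (fun x => hax _ x)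

/-! ## §2  The best typed decomposition: remove the RATE on both sides of line `registered`

Line `registered` = (criterion with log³-rate, Seregin 2022, DISCHARGED) ∧ (a-priori log³ axis
modulus of the swirl, OPEN ≡ crux).  Trading rate for smallness gives the split below:
`SmallSwirlRegularity` (an ε-regularity criterion in terms of the scale-invariant swirl `Γ = r u_θ`
alone, absolute `ε`: the `d = 1` endpoint of Chen–Fang–Zhang 2017 Thm 1.1(2) / log-power `0` of
Lei–Zhang 2017 Cor 1.3 and Wei 2016 — OPEN) and `SwirlEvacuation` (a priori, `Γ → 0` uniformly at
an axis point up to the final time — OPEN; the only printed a-priori moduli of `Γ` at the axis need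
a critical (weak-`L³`, Seregin 2020 / arXiv:2210.10030) or slightly supercritical (`A(R) ≲ (lnln 1/R)^β`,
Chen–Tsai–Zhang 2022 Prop 1.2) bound on the velocity, i.e. (almost) Type I, which a genuine axis
singularity violates (Seregin 2020: Type II); for general supercritical divergence-free drifts the
modulus is LOST (Silvestre–Vicol–Zlatoš 2013 Thm 1.3)).  The assembly `crux_of_split` is PROVED from
the landed stubs 1, K, 2b'.  `AxisBoundedNearTop` is the localised crux both pieces sandwich. -/

/-- Piece 1 — SMALL-SWIRL ε-REGULARITY at an axis point (absolute ε, dimensionless via `ε ν`). -/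
def SmallSwirlRegularity : Prop :=
  ∃ ε : ℝ, 0 < ε ∧ ∀ ν : ℝ, 0 < ν → ∀ T : ℝ, 0 < T → ∀ (u₀ : ℝ³ → ℝ³)
    (g : HomSobolev ℝ³ (EuclideanSpace ℂ (Fin 3)) (1 / 2 : ℝ)) (u : ℝ → ℝ³ → ℝ³),
    g.Represents (Literature.Analysis.FunctionSpaces.EuclideanSpace.complexify ∘ u₀) →
    IsKatoSolutionOn T ν u₀ u → ContDiffOn ℝ (⊤ : ℕ∞) (uncurry u) (Ioo 0 T ×ˢ univ) →
    (∀ t ∈ Ioo 0 T, IsAxisymmetric (u t)) →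
    ∀ x₀ : ℝ³, cylRadius x₀ = 0 → ∀ r : ℝ, 0 < r → r ^ 2 < T →
      (∀ t ∈ Ioo (T - r ^ 2) T, ∀ x ∈ ball x₀ r, |swirl (u t) x| ≤ ε * ν) →
      IsBoundedNearTop u T x₀

/-- Piece 2 — SWIRL EVACUATION at axis points up to the final time (a priori, no rate). -/
def SwirlEvacuation : Prop :=
  ∀ ε : ℝ, 0 < ε → ∀ ν : ℝ, 0 < ν → ∀ T : ℝ, 0 < T → ∀ (u₀ : ℝ³ → ℝ³)
    (g : HomSobolev ℝ³ (EuclideanSpace ℂ (Fin 3)) (1 / 2 : ℝ)) (u : ℝ → ℝ³ → ℝ³),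
    g.Represents (Literature.Analysis.FunctionSpaces.EuclideanSpace.complexify ∘ u₀) →
    IsKatoSolutionOn T ν u₀ u → ContDiffOn ℝ (⊤ : ℕ∞) (uncurry u) (Ioo 0 T ×ˢ univ) →
    (∀ t ∈ Ioo 0 T, IsAxisymmetric (u t)) →
    ∀ x₀ : ℝ³, cylRadius x₀ = 0 →
      ∃ r : ℝ, 0 < r ∧ r ^ 2 < T ∧ ∀ t ∈ Ioo (T - r ^ 2) T, ∀ x ∈ ball x₀ r, |swirl (u t) x| ≤ ε * ν

/-- The localised crux (what both registered lines reduce `AxisymmetricKatoGlobal` to): an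
axisymmetric Kato solution, smooth inside, is bounded near `(T, x₀)` for every AXIS point `x₀`. -/
def AxisBoundedNearTop : Prop :=
  ∀ ν : ℝ, 0 < ν → ∀ T : ℝ, 0 < T → ∀ (u₀ : ℝ³ → ℝ³)
    (g : HomSobolev ℝ³ (EuclideanSpace ℂ (Fin 3)) (1 / 2 : ℝ)) (u : ℝ → ℝ³ → ℝ³),
    g.Represents (Literature.Analysis.FunctionSpaces.EuclideanSpace.complexify ∘ u₀) →
    IsKatoSolutionOn T ν u₀ u → ContDiffOn ℝ (⊤ : ℕ∞) (uncurry u) (Ioo 0 T ×ˢ univ) →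
    (∀ t ∈ Ioo 0 T, IsAxisymmetric (u t)) →
    ∀ x₀ : ℝ³, cylRadius x₀ = 0 → IsBoundedNearTop u T x₀

/-- The localised crux implies the crux (by contradiction through the landed stubs 1, K, 2b'). -/
theorem crux_of_axisBounded (h : AxisBoundedNearTop) :
    Theses.AxisymmetricExtremality.AxisymmetricKatoGlobal := by
  intro ν hν u₀ g hL3 hrep hdiv hax
  have hax' : IsAxisymmetric u₀ := fun θ x => hax θ x
  by_contra hng
  obtain ⟨T, hT, xs, u, hK, hsm, haxi, hsing⟩ :=
    Registered.stub_katoAxisymSingularPoint ν hν u₀ hL3 hdiv hax' hng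
  obtain ⟨p, hpax, hsw, hloc⟩ := Registered.stub_katoLocalEnergyNearTop ν hν T hT u₀ u hK hsm haxi
  have hbdd : IsBoundedNearTop u T xs := by
    by_cases h0 : cylRadius xs = 0
    · exact h ν hν T hT u₀ g u hrep hK hsm haxi xs h0
    · exact Registered.stub_offAxisBounded_of_localEnergy ν hν T hT u p hsm haxi hsw hloc xs h0
  obtain ⟨r, hr, K, hbd⟩ := hbdd
  exact absurd (hsing r hr) (Registered.eLpNorm_parabolicCylinder_lt_top_of_forall_le hbd).ne

/-- The two pieces give the localised crux (pure composition). -/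
theorem axisBounded_of_split (h₁ : SmallSwirlRegularity) (h₂ : SwirlEvacuation) :
    AxisBoundedNearTop := by
  obtain ⟨ε, hε, hcrit⟩ := h₁
  intro ν hν T hT u₀ g u hrep hK hsm hax x₀ hx₀
  obtain ⟨r, hr, hrT, hsmall⟩ := h₂ ε hε ν hν T hT u₀ g u hrep hK hsm hax x₀ hx₀
  exact hcrit ν hν T hT u₀ g u hrep hK hsm hax x₀ hx₀ r hr hrT hsmall

/-- **Assembly of the split, PROVED**: `SmallSwirlRegularity → SwirlEvacuation → crux`. -/
theorem crux_of_split (h₁ : SmallSwirlRegularity) (h₂ : SwirlEvacuation) :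
    Theses.AxisymmetricExtremality.AxisymmetricKatoGlobal :=
  crux_of_axisBounded (axisBounded_of_split h₁ h₂)

/-- `|Γ(x)| ≤ r · |u(x)|` (Cauchy–Schwarz in the horizontal plane). [folklore] -/
theorem abs_swirl_le (u : ℝ³ → ℝ³) (x : ℝ³) : |swirl u x| ≤ cylRadius x * ‖u x‖ := by
  have h2 : 0 ≤ cylRadius x * ‖u x‖ := mul_nonneg (cylRadius_nonneg x) (norm_nonneg _)
  have h1 : (swirl u x) ^ 2 ≤ (cylRadius x * ‖u x‖) ^ 2 := by
    rw [mul_pow, cylRadius_sq, EuclideanSpace.norm_eq, Real.sq_sqrt (by positivity)]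
    simp only [swirl, Fin.sum_univ_three, Real.norm_eq_abs, sq_abs]
    nlinarith [sq_nonneg (x 0 * u x 0 + x 1 * u x 1),
      mul_nonneg (add_nonneg (sq_nonneg (x 0)) (sq_nonneg (x 1))) (sq_nonneg (u x 2))]
  calc |swirl u x| ≤ |cylRadius x * ‖u x‖| := sq_le_sq.1 h1
    _ = cylRadius x * ‖u x‖ := abs_of_nonneg h2

/-- Piece 2 is a CONSEQUENCE of the localised crux: boundedness near `(T, x₀)` evacuates the swirl
(`|Γ| ≤ r K`).  So `AxisBoundedNearTop ⇒ SwirlEvacuation ⇒ (SmallSwirlRegularity → AxisBoundedNearTop)`: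
the a-priori piece is sandwiched between the crux and the crux-minus-an-open-criterion. -/
theorem swirlEvacuation_of_axisBounded (h : AxisBoundedNearTop) : SwirlEvacuation := by
  intro ε hε ν hν T hT u₀ g u hrep hK hsm hax x₀ hx₀
  obtain ⟨r, hr, K, hbd⟩ := h ν hν T hT u₀ g u hrep hK hsm hax x₀ hx₀
  -- shrink the radius: r' ≤ r, r' (|K| + 1) ≤ ε ν, r'² < T
  set r' : ℝ := min r (min (ε * ν / (|K| + 1)) (Real.sqrt T / 2)) with hr'_def
  have hK1 : 0 < |K| + 1 := by positivity
  have hr'pos : 0 < r' := lt_min hr (lt_min (div_pos (mul_pos hε hν) hK1) (by positivity))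
  have hr'le : r' ≤ r := min_le_left _ _
  have hr'ε : r' ≤ ε * ν / (|K| + 1) := (min_le_right _ _).trans (min_le_left _ _)
  have hr'T : r' ≤ Real.sqrt T / 2 := (min_le_right _ _).trans (min_le_right _ _)
  refine ⟨r', hr'pos, ?_, fun t ht x hx => ?_⟩
  · have hsq : Real.sqrt T ^ 2 = T := Real.sq_sqrt hT.le
    nlinarith [hr'T, hr'pos, Real.sqrt_nonneg T, hsq]
  · have hb := IsBoundedNearTop.of_le hr'pos hr'le hbd t ht x hx
    have hxr : cylRadius x ≤ r' := by
      have h1 := cylRadius_le_cylRadius_add_norm_sub x₀ x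
      rw [hx₀, zero_add] at h1
      exact h1.trans (le_of_lt (by simpa [dist_eq_norm] using hx))
    calc |swirl (u t) x| ≤ cylRadius x * ‖u t x‖ := abs_swirl_le (u t) x
      _ ≤ r' * |K| := mul_le_mul hxr (hb.trans (le_abs_self K)) (norm_nonneg _) hr'pos.le
      _ ≤ ε * ν / (|K| + 1) * (|K| + 1) :=
          mul_le_mul hr'ε (by linarith [abs_nonneg K]) (abs_nonneg K)
            (div_pos (mul_pos hε hν) hK1).le
      _ = ε * ν := div_mul_cancel₀ _ hK1.ne'

/-! ## §3  Transfer exhibit: the solved sibling inside the crux (swirl-free = mirror-symmetric stratum)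

The crux restricted to data fixed by conjugation with the meridian reflection `σ(x₀,x₁,x₂) =
(x₀,−x₁,x₂)` (i.e. `O(2)`-symmetric rather than `SO(2)`-symmetric data) is a THEOREM of the tree:
such data are swirl-free (`IsAxisymmetric.hasNoSwirl_of_conj_reflY_eq`) and the swirl-free stratum
is landed (`axisymmetricKatoGlobal_noSwirl_stratum`).  The transferring step (maximum principle for
`ω_θ / r`) breaks exactly at the swirl source `∂_z Γ² / r⁴`; see the census. -/

/-- The `O(2)`-symmetric (mirror + axisymmetric) stratum of the crux holds, for every viscosity. -/
theorem crux_mirror_stratum :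
    ∀ ν : ℝ, 0 < ν → ∀ (u₀ : ℝ³ → ℝ³) (g : HomSobolev ℝ³ (EuclideanSpace ℂ (Fin 3)) (1 / 2 : ℝ)),
      MemLp u₀ 3 volume → g.Represents (Literature.Analysis.FunctionSpaces.EuclideanSpace.complexify ∘ u₀) →
      IsWeaklyDivFree u₀ → IsAxisymmetric u₀ → (∀ x, reflY (u₀ (reflY.symm x)) = u₀ x) →
      HasGlobalKatoSolution ν u₀ := by
  intro ν hν u₀ g hL3 _hrep hdiv hax hrefl
  exact NoSwirlStratum.axisymmetricKatoGlobal_noSwirl_stratum ν hν u₀ hL3 hdiv (fun θ x => hax θ x)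
    (hax.hasNoSwirl_of_conj_reflY_eq hrefl)

/-- Hence W₀ holds on the mirror-symmetric stratum: no `O(2)`-symmetric minimal blow-up datum. -/
theorem noMirrorSymmetricMinimalDatum :
    ∀ ν : ℝ, 0 < ν → ∀ (u₀ : ℝ³ → ℝ³) (g : HomSobolev ℝ³ (EuclideanSpace ℂ (Fin 3)) (1 / 2 : ℝ)),
      IsMinimalBlowupDatum ν u₀ g → IsAxisymmetric u₀ → (∀ x, reflY (u₀ (reflY.symm x)) = u₀ x) →
      False := by
  intro ν hν u₀ g hmin hax hrefl
  obtain ⟨hL3, hrep, hdiv, -, hnot⟩ := hmin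
  exact hnot (crux_mirror_stratum ν hν u₀ g hL3 hrep hdiv hax hrefl)

/-! ## §4  Strengthenings recorded as signatures (no proof claimed; see census `## Strengthen`)

`AxisBoundedNearTop` above is the local strengthening S⁺₁ in Kato clothes (proved ⇒ crux).  The
Liouville strengthening S⁺₂ is typed over the tree's ancient-mild vocabulary; it is NOT claimed to
imply the crux — the census explains the constant-limit loophole (it re-proves Type I exclusion only). -/

/-- S⁺₂ (KNSS-type Liouville, axisymmetric class WITH swirl, no decay hypothesis): every bounded
ancient mild solution (`ν = 1`) with axisymmetric slices is constant in space at a.e. level.  OPEN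
(KNSS 2009 conjecture restricted to the axisymmetric class; known under `|u| ≤ C/r`, KNSS Thm 5.3 =
tree `knss_bound_C_over_r_holds`, and without swirl). -/
def AxisymBoundedAncientLiouville : Prop :=
  ∀ u : ℝ → ℝ³ → ℝ³, IsBoundedAncientMildSolution 1 u → (∀ t < 0, IsAxisymmetric (u t)) →
    ∀ t < 0, ∃ c : ℝ³, u t =ᵐ[volume] fun _ => c

end Summit.NavierStokesRegularity.NavierStokesRegularity.Cruxes.AxisymmetricKatoGlobal.StrategistS12g13

end
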